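import Literature.NumberTheory.Automorphic.RestrictedProductBoxes
import Literature.NumberTheory.Automorphic.RestrictedTensorProductAdmissibleProofs
import Literature.NumberTheory.Automorphic.RestrictedTensorProductIrreducibleProofs
import Literature.NumberTheory.Automorphic.FlathLocalLemmas
import Literature.NumberTheory.Automorphic.HeckeCommonEigenvector
import Literature.NumberTheory.Automorphic.SmoothRepresentation
import Mathlib.LinearAlgebra.Finsupp.LinearCombination
import HarnessLib

/-!
# Flath's theorem, existence half: the purified base vector

Topic `NumberTheory/Automorphic`; theorems only. Third layer of the internal proof of
`Literature.NumberTheory.Automorphic.flath_exists` (`AutomorphicGLn`; Flath, *Decomposition of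
representations into tensor products*, Corvallis 1979, Thm. 3 with Thm. 2 and Example 2; Bump,
*Automorphic forms and representations* (1997), §3.4, Thm. 3.4.2 and Thm. 3.4.4).

Let `π` be an irreducible admissible representation of `Γ = Πʳ i, [G i, K i]` (topological groups
`G i`, compact open `K i`, `(G i, K i)` a Gelfand pair for almost all `i`) on `W`, over an
algebraically closed field `k` of characteristic `0`. Write `ι_i = mulSingleHom K i : G i →* Γ`,
`π_i = π ∘ ι_i` and, for `w ∈ W`, `C_i(w) = span {π(ι_i g) w | g ∈ G i}` (the cyclic `G i`-module
of `w`). The main result `exists_flathBaseVector` produces a box subgroup `U = ∏ L i`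
(`boxSubgroup L`: `L i ≤ K i` compact open, `L i = K i` for almost all `i`) and a vector
`w⋆ ∈ W^U`, `w⋆ ≠ 0`, such that

* for **every** `i`, `C_i(w⋆)` is an irreducible `G i`-stable subspace of `W` (its only
  `G i`-stable subspaces are `⊥` and itself), contained in the vectors fixed by the box with
  trivial `i`-th side; and
* for all but finitely many `i`, `C_i(w⋆) ∩ W^{ι_i(K i)} = k w⋆` (so `C_i(w⋆)` is `K i`-spherical
  with spherical vector `w⋆`).

In `AutomorphicGLnFlathProofs` the `C_i(w⋆)` are shown to be admissible and to be the local
factors of `π`: `π ≅ ⊗'_i (C_i(w⋆), w⋆)`.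

## The argument (Flath's Thm. 2 under commutativity only; cf. Bump, Exercise 3.4.6)

1. (`exists_boxSubgroup_fixedPoints_ne_bot`) Smoothness gives a box `U = ∏ L i` fixing a non-zero
   vector; `W^U` is finite-dimensional (admissibility).
2. (`inf_fixedPoints_comp_ne_bot`, from `FlathLocalLemmas`) **Dichotomy**: every non-zero
   `ι_i(G i)`-stable subspace of `W` has a non-zero `ι_i(L i)`-fixed vector.
3. (`exists_common_heckeEigenvector`) At the good places (`L i = K i`, Gelfand pair) the local
   Hecke operators `P_{i,g} = heckeOperator π_i (K i) g` preserve `W^U` and commute there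
   (`IsGelfandPair.heckeOperator_comm_apply` at one place, trivially at two places), so they have
   a common eigenvector `w₁ ∈ W^U` (`exists_common_eigenvector_of_forall_comm`). For such an
   eigenvector `C_i(w) ∩ W^{ι_i K_i} = k w` (`exists_eq_smul_of_mem_span_of_heckeEigenvector`),
   whence `C_i(w)` is irreducible by the dichotomy (`irreducible_span_of_heckeEigenvector`).
4. (`exists_purified`) **Purification** at the finitely many bad places `i₀`, one at a time:
   inside `C_{i₀}(w)` there is an irreducible `G_{i₀}`-stable `V` with a non-zero `L_{i₀}`-fixed
   vector `w'` (`exists_irreducible_stable_le`); then `w' ∈ W^U`, `C_{i₀}(w') = V`, and `w' = T w`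
   for some `T ∈ span π(ι_{i₀} G_{i₀})`, which commutes with the other coordinates — so
   irreducibility of `C_i(w)` at the places already treated and the eigenvector property at the
   good places pass to `w'` (`map_stable_irreducible_of_comm`).

## References

* D. Flath, *Decomposition of representations into tensor products*, Proc. Sympos. Pure Math. 33
  (1979), part 1, 179–183, Thm. 2, Thm. 3, Example 2 [FlathCorvallis1979].
* D. Bump, *Automorphic forms and representations* (1997), §3.4, pp. 301–317 (Thm. 3.4.2,
  Thm. 3.4.4, Exercise 3.4.6) and Prop. 4.2.3, Thm. 4.6.2 [Bump1997].
-/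

noncomputable section

open scoped RestrictedProduct
open Filter MulAction
open _root_.Topology

namespace Literature.NumberTheory.Automorphic

universe u v w uk

variable {ι : Type u} [DecidableEq ι] {G : ι → Type v} [∀ i, Group (G i)]
  {K : ∀ i, Subgroup (G i)} {k : Type uk} [Field k] {W : Type w} [AddCommGroup W] [Module k W]
  (π : Representation k (Πʳ i, [G i, K i]) W)

/-! ### Fixed vectors of boxes and of the coordinate subgroups -/

section Algebra

/-- A vector fixed by the box `∏ L j` is fixed by `L i` acting through the `i`-th coordinate. [folklore] -/
theorem fixedPoints_boxSubgroup_le (L : ∀ i, Subgroup (G i)) (i : ι) :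
    π.fixedPoints (boxSubgroup L) ≤
      Representation.fixedPoints (π.comp (mulSingleHom K i)) (L i) := by
  intro w hw
  rw [Representation.mem_fixedPoints] at hw ⊢
  intro g hg
  exact hw _ (mulSingle_mem_boxSubgroup_iff.2 hg)

/-- An element of the box with trivial `i`-th side has `i`-th coordinate `1`. [folklore] -/
theorem apply_eq_one_of_mem_boxSubgroup_update_bot {L : ∀ i, Subgroup (G i)} {i : ι}
    {c : Πʳ i, [G i, K i]} (hc : c ∈ boxSubgroup (K := K) (Function.update L i ⊥)) : c i = 1 :=
  (Subgroup.mem_bot).1 (apply_mem_of_mem_boxSubgroup_update hc)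

/-- An element of the box with trivial `i`-th side commutes with the `i`-th coordinate
embedding. [folklore] -/
theorem mul_mulSingleHom_comm_of_mem_boxSubgroup_update_bot {L : ∀ i, Subgroup (G i)} {i : ι}
    {c : Πʳ i, [G i, K i]} (hc : c ∈ boxSubgroup (K := K) (Function.update L i ⊥)) (x : G i) :
    c * mulSingleHom K i x = mulSingleHom K i x * c :=
  mul_mulSingle_comm_of_apply_eq_one (apply_eq_one_of_mem_boxSubgroup_update_bot hc) x

/-- **Fixed vectors of a box, one coordinate split off.** A vector is fixed by the box
`∏_{j ≠ i} L j × L'` iff it is fixed by the box `∏_{j ≠ i} L j × 1` with trivial `i`-th side and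
by `L'` acting through the `i`-th coordinate. [folklore] -/
theorem mem_fixedPoints_boxSubgroup_update_iff (L : ∀ i, Subgroup (G i)) (i : ι)
    (L' : Subgroup (G i)) (w : W) :
    w ∈ π.fixedPoints (boxSubgroup (Function.update L i L')) ↔
      w ∈ π.fixedPoints (boxSubgroup (Function.update L i ⊥)) ∧
        w ∈ Representation.fixedPoints (π.comp (mulSingleHom K i)) L' := by
  constructor
  · intro hw
    refine ⟨Representation.fixedPoints_antitone π (boxSubgroup_mono fun j => ?_) hw, ?_⟩
    · by_cases hj : j = i
      · subst hj
        simp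
      · simp [Function.update_of_ne hj]
    · rw [Representation.mem_fixedPoints] at hw ⊢
      intro g hg
      exact hw _ (mulSingle_mem_boxSubgroup_iff.2 (by simpa using hg))
  · rintro ⟨h1, h2⟩
    rw [Representation.mem_fixedPoints] at h1 h2 ⊢
    intro c hc
    obtain ⟨c', hc', hc'i, hci, hcc⟩ := exists_mem_boxSubgroup_eq_mul_mulSingle hc
    have hc'' : c' ∈ boxSubgroup (K := K) (Function.update L i ⊥) := fun j => by
      by_cases hj : j = i
      · subst hj
        simpa using hc'i
      · simpa [Function.update_of_ne hj] using hc' j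
    rw [hcc, map_mul, Module.End.mul_apply]
    have : π (RestrictedProduct.mulSingle K i (c i)) w = w := h2 (c i) hci
    rw [this]
    exact h1 c' hc''

/-- The box with `i`-th side put back is the original box. [folklore] -/
theorem boxSubgroup_update_self (L : ∀ i, Subgroup (G i)) (i : ι) :
    boxSubgroup (K := K) (Function.update L i (L i)) = boxSubgroup L := by
  rw [Function.update_eq_self]

/-- A vector fixed by the box with trivial `i`-th side and by `L i` through the `i`-th coordinate
is fixed by the whole box. [folklore] -/
theorem mem_fixedPoints_boxSubgroup_of (L : ∀ i, Subgroup (G i)) (i : ι) {w : W}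
    (h1 : w ∈ π.fixedPoints (boxSubgroup (Function.update L i ⊥)))
    (h2 : w ∈ Representation.fixedPoints (π.comp (mulSingleHom K i)) (L i)) :
    w ∈ π.fixedPoints (boxSubgroup L) := by
  rw [← boxSubgroup_update_self L i, mem_fixedPoints_boxSubgroup_update_iff]
  exact ⟨h1, h2⟩

/-- A vector fixed by a box is fixed by the box with trivial `i`-th side. [folklore] -/
theorem mem_fixedPoints_boxSubgroup_update_bot (L : ∀ i, Subgroup (G i)) (i : ι) {w : W}
    (hw : w ∈ π.fixedPoints (boxSubgroup L)) :
    w ∈ π.fixedPoints (boxSubgroup (Function.update L i ⊥)) := by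
  rw [← boxSubgroup_update_self L i, mem_fixedPoints_boxSubgroup_update_iff] at hw
  exact hw.1

/-! ### Cyclic `G i`-modules inside `W` -/

/-- The cyclic module `C_i(w) = span {π(ι_i g) w}` is stable under `ι_i(G i)`. [folklore] -/
theorem apply_mem_span_range_mulSingleHom (i : ι) (w : W) (h : G i) {x : W}
    (hx : x ∈ Submodule.span k (Set.range fun g : G i => π (mulSingleHom K i g) w)) :
    π (mulSingleHom K i h) x ∈ Submodule.span k (Set.range fun g : G i => π (mulSingleHom K i g) w) := by
  induction hx using Submodule.span_induction with
  | mem x hx =>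
    obtain ⟨g, rfl⟩ := hx
    exact Submodule.subset_span ⟨h * g, by simp only [map_mul, Module.End.mul_apply]⟩
  | zero => simp
  | add x y _ _ hx hy =>
    rw [map_add]
    exact Submodule.add_mem _ hx hy
  | smul a x _ hx =>
    rw [map_smul]
    exact Submodule.smul_mem _ a hx

/-- `w ∈ C_i(w)`. [folklore] -/
theorem self_mem_span_range_mulSingleHom (i : ι) (w : W) :
    w ∈ Submodule.span k (Set.range fun g : G i => π (mulSingleHom K i g) w) :=
  Submodule.subset_span ⟨1, by simp only [map_one, Module.End.one_apply]⟩

/-- `C_i(w) = 0` iff `w = 0`. [folklore] -/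
theorem span_range_mulSingleHom_ne_bot (i : ι) {w : W} (hw : w ≠ 0) :
    Submodule.span k (Set.range fun g : G i => π (mulSingleHom K i g) w) ≠ ⊥ := fun h =>
  hw ((Submodule.mem_bot k).1 (h ▸ self_mem_span_range_mulSingleHom π i w))

/-- A `G i`-stable subspace containing `w` contains `C_i(w)`. [folklore] -/
theorem span_range_mulSingleHom_le (i : ι) {w : W} {Y : Submodule k W}
    (hY : ∀ g : G i, ∀ y ∈ Y, π (mulSingleHom K i g) y ∈ Y) (hw : w ∈ Y) :
    Submodule.span k (Set.range fun g : G i => π (mulSingleHom K i g) w) ≤ Y := by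
  rw [Submodule.span_le]
  rintro _ ⟨g, rfl⟩
  exact hY g w hw

/-- An endomorphism commuting with `ι_i(G i)` maps `C_i(w)` onto `C_i(T w)`. [folklore] -/
theorem map_span_range_mulSingleHom (i : ι) (w : W) (T : W →ₗ[k] W)
    (hT : ∀ (x : G i) (v : W), T (π (mulSingleHom K i x) v) = π (mulSingleHom K i x) (T v)) :
    (Submodule.span k (Set.range fun g : G i => π (mulSingleHom K i g) w)).map T =
      Submodule.span k (Set.range fun g : G i => π (mulSingleHom K i g) (T w)) := by
  rw [Submodule.map_span, ← Set.range_comp]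
  have : ((⇑T) ∘ fun g : G i => π (mulSingleHom K i g) w) = fun g => π (mulSingleHom K i g) (T w) :=
    funext fun g => hT g w
  rw [this]

/-- If `w` is fixed by the box `∏_{j ≠ i} L j × 1` (trivial `i`-th side), so is all of `C_i(w)`:
the elements of that box commute with `ι_i(G i)`. [folklore] -/
theorem span_range_mulSingleHom_le_fixedPoints_update_bot (L : ∀ i, Subgroup (G i)) (i : ι)
    {w : W} (hw : w ∈ π.fixedPoints (boxSubgroup (Function.update L i ⊥))) :
    Submodule.span k (Set.range fun g : G i => π (mulSingleHom K i g) w) ≤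
      π.fixedPoints (boxSubgroup (Function.update L i ⊥)) := by
  rw [Submodule.span_le]
  rintro _ ⟨g, rfl⟩
  show π (mulSingleHom K i g) w ∈ π.fixedPoints (boxSubgroup (Function.update L i ⊥))
  rw [Representation.mem_fixedPoints] at hw ⊢
  intro c hc
  rw [← Module.End.mul_apply, ← map_mul, mul_mulSingleHom_comm_of_mem_boxSubgroup_update_bot hc,
    map_mul, Module.End.mul_apply, hw c hc]

/-- The stabiliser of `v` for `π ∘ ι_i` is the preimage of its stabiliser for `π`. [folklore] -/
theorem stabilizerSubgroup_comp_mulSingleHom (i : ι) (v : W) :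
    Representation.stabilizerSubgroup (π.comp (mulSingleHom K i)) v =
      (π.stabilizerSubgroup v).comap (mulSingleHom K i) := by
  ext g
  rfl

end Algebra

/-! ### Smoothness along a coordinate; the dichotomy; finiteness -/

section Topology

variable [∀ i, TopologicalSpace (G i)]

/-- If `π` is smooth, so is `π ∘ ι_i` (the coordinate embedding is continuous). [folklore] -/
theorem isSmooth_comp_mulSingleHom (hπ : π.IsSmooth) (i : ι) :
    Representation.IsSmooth (π.comp (mulSingleHom K i)) := by
  intro v
  change IsOpen ((Representation.stabilizerSubgroup (π.comp (mulSingleHom K i)) v : Set (G i)))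
  rw [stabilizerSubgroup_comp_mulSingleHom]
  exact (hπ v).preimage (continuous_mulSingleHom i)

variable [∀ i, IsTopologicalGroup (G i)]

/-- For `π` smooth and `L ≤ G i` compact, `L ∩ Stab(v)` has finite index in `L` for every vector
`v` (the hypothesis `hL` of the dichotomy lemma `fixedPoints_comp_eq_bot_of_inf_eq_bot`). [folklore] -/
theorem finiteIndex_stabilizer_subgroupOf (hπ : π.IsSmooth) {i : ι} {L : Subgroup (G i)}
    (hLc : IsCompact (L : Set (G i))) (v : W) :
    ((Representation.stabilizerSubgroup (π.comp (mulSingleHom K i)) v).subgroupOf L).FiniteIndex :=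
  ⟨relIndex_ne_zero_of_isOpen_of_isCompact (isSmooth_comp_mulSingleHom π hπ i v) hLc⟩

/-- **Dichotomy in a restricted product.** Let `π` be an irreducible smooth representation of
`Πʳ i, [G i, K i]` over a field of characteristic `0`, `L ≤ G i` compact, and suppose some
non-zero vector is fixed by `ι_i(L)`. Then every non-zero `ι_i(G i)`-stable subspace of `W`
contains a non-zero `ι_i(L)`-fixed vector (`FlathLocalLemmas.inf_fixedPoints_ne_bot_of_stable`
with the factorisation `γ = c · ι_i(γ i)`). [folklore] -/
theorem inf_fixedPoints_comp_ne_bot [CharZero k] [π.IsIrreducible] (hπ : π.IsSmooth) {i : ι}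
    {L : Subgroup (G i)} (hLc : IsCompact (L : Set (G i)))
    (hW : Representation.fixedPoints (π.comp (mulSingleHom K i)) L ≠ ⊥)
    {Z : Submodule k W} (hZ : ∀ g : G i, ∀ z ∈ Z, π (mulSingleHom K i g) z ∈ Z) (hZ0 : Z ≠ ⊥) :
    Z ⊓ Representation.fixedPoints (π.comp (mulSingleHom K i)) L ≠ ⊥ :=
  inf_fixedPoints_ne_bot_of_stable π (mulSingleHom K i) L (exists_eq_mul_mulSingleHom i)
    (finiteIndex_stabilizer_subgroupOf π hπ hLc) hW hZ hZ0

omit [DecidableEq ι] [∀ i, IsTopologicalGroup (G i)] in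
/-- The `K'`-fixed vectors of an admissible representation are finite-dimensional for a compact
open box `K' = ∏ L i` (`L i ≤ K i` compact open, `= K i` almost everywhere). [folklore] -/
theorem finite_fixedPoints_boxSubgroup (hadm : π.IsAdmissible) {L : ∀ i, Subgroup (G i)}
    (hLo : ∀ i, IsOpen (L i : Set (G i))) (hLc : ∀ i, IsCompact (L i : Set (G i)))
    (hLK : ∀ i, L i ≤ K i) (hLK' : ∀ᶠ i in cofinite, L i = K i) :
    Module.Finite k ↥(π.fixedPoints (boxSubgroup L)) :=
  hadm.2 ⟨boxSubgroup L, isOpen_boxSubgroup hLo (hLK'.mono fun _ hi => hi ▸ le_rfl)⟩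
    (isCompact_boxSubgroup hLK hLc)

omit [∀ i, IsTopologicalGroup (G i)] in
/-- The same for the box with `i`-th side replaced by a compact open `L' ≤ K i`. [folklore] -/
theorem finite_fixedPoints_boxSubgroup_update (hadm : π.IsAdmissible) {L : ∀ i, Subgroup (G i)}
    (hLo : ∀ i, IsOpen (L i : Set (G i))) (hLc : ∀ i, IsCompact (L i : Set (G i)))
    (hLK : ∀ i, L i ≤ K i) (hLK' : ∀ᶠ i in cofinite, L i = K i) (i : ι) {L' : Subgroup (G i)}
    (hL'o : IsOpen (L' : Set (G i))) (hL'c : IsCompact (L' : Set (G i))) (hL'K : L' ≤ K i) :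
    Module.Finite k ↥(π.fixedPoints (boxSubgroup (Function.update L i L'))) := by
  refine finite_fixedPoints_boxSubgroup π hadm (fun j => ?_) (fun j => ?_) (fun j => ?_) ?_
  · by_cases hj : j = i
    · subst hj; simpa using hL'o
    · simpa [Function.update_of_ne hj] using hLo j
  · by_cases hj : j = i
    · subst hj; simpa using hL'c
    · simpa [Function.update_of_ne hj] using hLc j
  · by_cases hj : j = i
    · subst hj; simpa using hL'K
    · simpa [Function.update_of_ne hj] using hLK j
  · refine (hLK'.and (eventually_cofinite_ne i)).mono fun j hj => ?_
    rw [Function.update_of_ne hj.2, hj.1]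

/-- **Small boxes inside an open subgroup (topological groups).** Let the `G i` be topological
groups and the `K i` compact open. Then every subgroup `N` of `Πʳ i, [G i, K i]` which is a
neighbourhood of `1` contains a box subgroup `∏ L i` with compact open sides `L i ≤ K i` and
`L i = K i` for all but finitely many `i`: `𝓝 1` is the image of `𝓝 1` in `∏ K i` (Mathlib
`RestrictedProduct.nhds_eq_map_structureMap`), a basic neighbourhood there constrains finitely
many coordinates `i ∈ I` by neighbourhoods `t i` of `1` in `K i`, and for `i ∈ I` one may take for
`L i` the (open, hence closed and compact) subgroup of `K i` generated by `t i`. (No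
`NonarchimedeanGroup` hypothesis is needed, unlike in `exists_boxSubgroup_subset`, because `N`
is a subgroup.) (Flath 1979, §2, Example 2; Bump 1997, §3.3.) [folklore] -/
theorem exists_boxSubgroup_le_of_mem_nhds (hK : ∀ i, IsOpen (K i : Set (G i)))
    (hKc : ∀ i, IsCompact (K i : Set (G i))) (N : Subgroup (Πʳ i, [G i, K i]))
    (hN : (N : Set (Πʳ i, [G i, K i])) ∈ 𝓝 (1 : Πʳ i, [G i, K i])) :
    ∃ L : ∀ i, Subgroup (G i), (∀ i, IsOpen (L i : Set (G i))) ∧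
      (∀ i, IsCompact (L i : Set (G i))) ∧ (∀ i, L i ≤ K i) ∧ (∀ᶠ i in cofinite, L i = K i) ∧
      boxSubgroup (K := K) L ≤ N := by
  classical
  have h1 : RestrictedProduct.structureMap G (fun i => (K i : Set (G i))) cofinite
      (fun i => ⟨1, (K i).one_mem⟩) = 1 := DFunLike.ext _ _ fun i => rfl
  rw [← h1, RestrictedProduct.nhds_eq_map_structureMap hK, Filter.mem_map, nhds_pi,
    Filter.mem_pi'] at hN
  obtain ⟨I, t, ht, hIt⟩ := hN
  let L : ∀ i, Subgroup (G i) := fun i =>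
    if i ∈ I then Subgroup.closure (Subtype.val '' t i) else K i
  have hLI : ∀ i ∈ I, L i = Subgroup.closure (Subtype.val '' t i) := fun i hi => by
    simp only [L, hi, if_true]
  have hLI' : ∀ i ∉ I, L i = K i := fun i hi => by simp only [L, hi, if_false]
  have hLK : ∀ i, L i ≤ K i := fun i => by
    by_cases hi : i ∈ I
    · rw [hLI i hi, Subgroup.closure_le]
      rintro _ ⟨y, -, rfl⟩
      exact y.2
    · rw [hLI' i hi]
  have hLo : ∀ i, IsOpen (L i : Set (G i)) := fun i => by
    by_cases hi : i ∈ I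
    · rw [hLI i hi]
      refine Subgroup.isOpen_of_mem_nhds _ (g := 1) (Filter.mem_of_superset ?_ Subgroup.subset_closure)
      rw [← (hK i).isOpenEmbedding_subtypeVal.map_nhds_eq ⟨1, (K i).one_mem⟩]
      exact Filter.image_mem_map (ht i)
    · rw [hLI' i hi]
      exact hK i
  have hLc : ∀ i, IsCompact (L i : Set (G i)) := fun i =>
    (hKc i).of_isClosed_subset ((L i).isClosed_of_isOpen (hLo i)) (hLK i)
  have hLK' : ∀ᶠ i in cofinite, L i = K i :=
    I.eventually_cofinite_notMem.mono fun i hi => hLI' i hi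
  refine ⟨L, hLo, hLc, hLK, hLK', ?_⟩
  -- the coordinate subgroups `ι_i(L i)`, `i ∈ I`, lie in `N`
  have hcoord : ∀ i ∈ I, ∀ y ∈ L i, RestrictedProduct.mulSingle K i y ∈ N := by
    intro i hi y hy
    have hle : Subgroup.closure (Subtype.val '' t i) ≤ N.comap (mulSingleHom K i) := by
      rw [Subgroup.closure_le]
      rintro _ ⟨z, hz, rfl⟩
      rw [SetLike.mem_coe, Subgroup.mem_comap, mulSingleHom_apply,
        ← restrictedProduct_structureMap_update_one]
      apply hIt
      intro l hl
      by_cases hli : l = i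
      · subst hli
        simpa using hz
      · rw [Function.update_of_ne hli]
        exact mem_of_mem_nhds (ht l)
    rw [hLI i hi] at hy
    exact hle hy
  -- induction on the set of coordinates in `I` allowed to be non-trivial
  have key : ∀ J : Finset ι, J ⊆ I → ∀ g ∈ boxSubgroup (K := K) L,
      (∀ i ∈ I, i ∉ J → g i = 1) → g ∈ N := by
    intro J
    induction J using Finset.induction_on with
    | empty =>
      intro _ g hg hg1
      have hgK : ∀ i, g i ∈ K i := fun i => hLK i (hg i)
      have hg' : RestrictedProduct.structureMap G (fun i => (K i : Set (G i))) cofinite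
          (fun i => ⟨g i, hgK i⟩) = g := DFunLike.ext _ _ fun i => rfl
      rw [← hg']
      apply hIt
      intro l hl
      have hl1 : (⟨g l, hgK l⟩ : ↥(K l : Set (G l))) = ⟨1, (K l).one_mem⟩ :=
        Subtype.ext (hg1 l (Finset.mem_coe.1 hl) (Finset.notMem_empty l))
      show (⟨g l, hgK l⟩ : ↥(K l : Set (G l))) ∈ t l
      rw [hl1]
      exact mem_of_mem_nhds (ht l)
    | insert a J ha ih =>
      intro hJI g hg hg1
      have haI : a ∈ I := hJI (Finset.mem_insert_self a J)
      have hh : g * (RestrictedProduct.mulSingle K a (g a))⁻¹ ∈ boxSubgroup (K := K) L :=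
        (boxSubgroup L).mul_mem hg
          ((boxSubgroup L).inv_mem (mulSingle_mem_boxSubgroup_iff.2 (hg a)))
      have hh1 : ∀ i ∈ I, i ∉ J → (g * (RestrictedProduct.mulSingle K a (g a))⁻¹) i = 1 := by
        intro i hi hiJ
        by_cases hia : i = a
        · subst hia
          exact mul_mulSingle_inv_apply_self g i
        · rw [mul_mulSingle_inv_apply_of_ne g hia]
          exact hg1 i hi (by simp [hia, hiJ])
      have hmem := ih (fun x hx => hJI (Finset.mem_insert_of_mem hx)) _ hh hh1
      rw [eq_mul_mulSingle g a]
      exact N.mul_mem hmem (hcoord a haI _ (hg a))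
  intro g hg
  exact key I subset_rfl g hg fun i hi hi' => absurd hi hi'

omit [DecidableEq ι] in
/-- **A non-zero fixed vector of a small box.** For an irreducible (hence non-zero) smooth
representation of `Πʳ i, [G i, K i]` (topological groups `G i`, compact open `K i`) some compact
open box `∏ L i`, `L i ≤ K i`, `L i = K i` for almost all `i`, fixes a non-zero vector
(`exists_boxSubgroup_le_of_mem_nhds` applied to an open stabiliser). (Flath 1979, §2; Bump 1997,
§3.4, p. 308: "there exists `e₁° ⊗ e₂°` with `M[e₁° ⊗ e₂°] ≠ 0`".) [folklore] -/
theorem exists_boxSubgroup_fixedPoints_ne_bot [π.IsIrreducible]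
    (hK : ∀ i, IsOpen (K i : Set (G i))) (hKc : ∀ i, IsCompact (K i : Set (G i)))
    (hπ : π.IsSmooth) :
    ∃ L : ∀ i, Subgroup (G i), (∀ i, IsOpen (L i : Set (G i))) ∧
      (∀ i, IsCompact (L i : Set (G i))) ∧ (∀ i, L i ≤ K i) ∧ (∀ᶠ i in cofinite, L i = K i) ∧
      π.fixedPoints (boxSubgroup L) ≠ ⊥ := by
  classical
  haveI : Nontrivial W := Representation.IsIrreducible.nontrivial π
  obtain ⟨w, hw⟩ := exists_ne (0 : W)
  have hN : ((π.stabilizerSubgroup w : Set (Πʳ i, [G i, K i]))) ∈ 𝓝 (1 : Πʳ i, [G i, K i]) :=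
    (hπ w).mem_nhds (π.stabilizerSubgroup w).one_mem
  obtain ⟨L, hLo, hLc, hLK, hLK', hsub⟩ :=
    exists_boxSubgroup_le_of_mem_nhds hK hKc (π.stabilizerSubgroup w) hN
  refine ⟨L, hLo, hLc, hLK, hLK', (Submodule.ne_bot_iff _).2 ⟨w, ?_, hw⟩⟩
  rw [Representation.mem_fixedPoints]
  intro g hg
  exact hsub hg

end Topology

/-! ### The local Hecke operators at the good places -/

section Hecke

variable [∀ i, TopologicalSpace (G i)] [∀ i, IsTopologicalGroup (G i)]

/-- The local Hecke operator `[K_i g K_i]` of `π ∘ ι_i` commutes with `π(c)` for every `c`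
commuting with `ι_i(G i)`. [folklore] -/
theorem apply_heckeOperator_comp_eq (i : ι) (hK : IsOpen (K i : Set (G i)))
    (hKc : IsCompact (K i : Set (G i))) (g : G i) {c : Πʳ i, [G i, K i]}
    (hc : ∀ x : G i, c * mulSingleHom K i x = mulSingleHom K i x * c) (v : W) :
    π c (heckeOperator (π.comp (mulSingleHom K i)) (K i) g v) =
      heckeOperator (π.comp (mulSingleHom K i)) (K i) g (π c v) := by
  haveI := isHeckeTriple_top_of_isCompact_isOpen (K i) hKc hK
  refine apply_heckeOperator_eq_of_forall_comm (π.comp (mulSingleHom K i)) (K i) g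
    (finite_orbit_quotient (K i) g) (π c) (fun x u => ?_) v
  change π c (π (mulSingleHom K i x) u) = π (mulSingleHom K i x) (π c u)
  rw [← Module.End.mul_apply, ← map_mul, hc x, map_mul, Module.End.mul_apply]

/-- Local Hecke operators at two different coordinates commute. [folklore] -/
theorem heckeOperator_comp_comm_of_ne {i j : ι} (hij : i ≠ j) (hKi : IsOpen (K i : Set (G i)))
    (hKci : IsCompact (K i : Set (G i))) (hKj : IsOpen (K j : Set (G j)))
    (hKcj : IsCompact (K j : Set (G j))) (g : G i) (g' : G j) (v : W) :
    heckeOperator (π.comp (mulSingleHom K i)) (K i) g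
        (heckeOperator (π.comp (mulSingleHom K j)) (K j) g' v) =
      heckeOperator (π.comp (mulSingleHom K j)) (K j) g'
        (heckeOperator (π.comp (mulSingleHom K i)) (K i) g v) := by
  haveI := isHeckeTriple_top_of_isCompact_isOpen (K j) hKcj hKj
  refine apply_heckeOperator_eq_of_forall_comm (π.comp (mulSingleHom K j)) (K j) g'
    (finite_orbit_quotient (K j) g') _ (fun y u => ?_) v
  exact (apply_heckeOperator_comp_eq π i hKi hKci g
    (fun x => (mulSingle_commute_of_ne hij x y).symm.eq) u).symm

/-- The local Hecke operators `[K_i g K_i]` of `π ∘ ι_i` preserve the vectors fixed by a box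
`∏ L j` with `L i = K i`. [folklore] -/
theorem heckeOperator_comp_mem_fixedPoints_boxSubgroup {L : ∀ i, Subgroup (G i)} {i : ι}
    (hLi : L i = K i) (hK : IsOpen (K i : Set (G i))) (hKc : IsCompact (K i : Set (G i)))
    (g : G i) {w : W} (hw : w ∈ π.fixedPoints (boxSubgroup L)) :
    heckeOperator (π.comp (mulSingleHom K i)) (K i) g w ∈ π.fixedPoints (boxSubgroup L) := by
  haveI := isHeckeTriple_top_of_isCompact_isOpen (K i) hKc hK
  refine mem_fixedPoints_boxSubgroup_of π L i ?_ ?_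
  · rw [Representation.mem_fixedPoints]
    intro c hc
    rw [apply_heckeOperator_comp_eq π i hK hKc g
      (mul_mulSingleHom_comm_of_mem_boxSubgroup_update_bot hc)]
    congr 1
    exact (Representation.mem_fixedPoints _ _ _).1
      (mem_fixedPoints_boxSubgroup_update_bot π L i hw) c hc
  · rw [hLi]
    exact heckeOperator_apply_mem_fixedPoints _ (K i) g
      (hLi ▸ fixedPoints_boxSubgroup_le π L i hw) (finite_orbit_quotient (K i) g)

/-- **A common eigenvector of the good local Hecke operators.** If `W^U ≠ 0` is
finite-dimensional (`U = ∏ L i`) and `k` is algebraically closed, some non-zero `w ∈ W^U` is an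
eigenvector of every local Hecke operator `[K_i g K_i]` of `π ∘ ι_i` at every *good* index `i`
(`L i = K i` and `(G i, K i)` a Gelfand pair): these operators preserve `W^U` and commute
pairwise on it (`IsGelfandPair.heckeOperator_comm_apply`, `heckeOperator_comp_comm_of_ne`).
This is the "simultaneous eigenspace for the commutative `H_v[e_v°]`" of Bump (1997), proof of
Thm. 3.4.4, p. 313, taken for all good `v` at once. [folklore] -/
theorem exists_common_heckeEigenvector [IsAlgClosed k] {L : ∀ i, Subgroup (G i)}
    (hK : ∀ i, IsOpen (K i : Set (G i))) (hKc : ∀ i, IsCompact (K i : Set (G i)))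
    [Module.Finite k ↥(π.fixedPoints (boxSubgroup L))] (hU : π.fixedPoints (boxSubgroup L) ≠ ⊥) :
    ∃ w ∈ π.fixedPoints (boxSubgroup L), w ≠ 0 ∧
      ∀ i, L i = K i → IsGelfandPair k (G i) (K i) → ∀ g : G i, ∃ c : k,
        heckeOperator (π.comp (mulSingleHom K i)) (K i) g w = c • w := by
  let 𝒮 : Set (W →ₗ[k] W) := {T | ∃ i, L i = K i ∧ IsGelfandPair k (G i) (K i) ∧
    ∃ g : G i, T = heckeOperator (π.comp (mulSingleHom K i)) (K i) g}
  have hstab : ∀ T ∈ 𝒮, ∀ m ∈ π.fixedPoints (boxSubgroup L), T m ∈ π.fixedPoints (boxSubgroup L) := by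
    rintro T ⟨i, hLi, -, g, rfl⟩ m hm
    exact heckeOperator_comp_mem_fixedPoints_boxSubgroup π hLi (hK i) (hKc i) g hm
  have hcomm : ∀ S ∈ 𝒮, ∀ T ∈ 𝒮, ∀ m ∈ π.fixedPoints (boxSubgroup L), S (T m) = T (S m) := by
    rintro S ⟨i, hLi, hGi, g, rfl⟩ T ⟨j, hLj, hGj, g', rfl⟩ m hm
    by_cases hij : i = j
    · subst hij
      haveI := isHeckeTriple_top_of_isCompact_isOpen (K i) (hKc i) (hK i)
      exact IsGelfandPair.heckeOperator_comm_apply (K i) hGi (π.comp (mulSingleHom K i)) g g'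
        (hLi ▸ fixedPoints_boxSubgroup_le π L i hm)
    · exact heckeOperator_comp_comm_of_ne π hij (hK i) (hKc i) (hK j) (hKc j) g g' m
  obtain ⟨w, hwU, hw0, hw⟩ :=
    exists_common_eigenvector_of_forall_comm (π.fixedPoints (boxSubgroup L)) hU 𝒮 hstab hcomm
  exact ⟨w, hwU, hw0, fun i hLi hGi g => hw _ ⟨i, hLi, hGi, g, rfl⟩⟩

/-- **The cyclic module of a spherical Hecke eigenvector is irreducible.** Let `π` be irreducible
and smooth over `k` of characteristic `0`, `U = ∏ L j` a box with `L i = K i` compact open,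
`w ∈ W^U` non-zero and an eigenvector of all the local Hecke operators `[K_i g K_i]`. Then the
`ι_i(K i)`-fixed vectors of `C_i(w)` are `k w`
(`exists_eq_smul_of_mem_span_of_heckeEigenvector`), and `C_i(w)` is irreducible: a non-zero
`G i`-stable `Y ≤ C_i(w)` has a non-zero `K i`-fixed vector by the dichotomy, which is a multiple
of `w`. (Bump (1997), Thm. 4.6.2 with Prop. 4.2.3; Cartier, Corvallis 1979, §IV.1; cf.
Flath 1979, proof of Thm. 2.) [folklore] -/
theorem irreducible_span_of_heckeEigenvector [CharZero k] [π.IsIrreducible] (hπ : π.IsSmooth)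
    {L : ∀ i, Subgroup (G i)} {i : ι} (hLi : L i = K i) (hK : IsOpen (K i : Set (G i)))
    (hKc : IsCompact (K i : Set (G i))) {w : W} (hwU : w ∈ π.fixedPoints (boxSubgroup L))
    (hw0 : w ≠ 0)
    (heig : ∀ g : G i, ∃ c : k, heckeOperator (π.comp (mulSingleHom K i)) (K i) g w = c • w) :
    Submodule.span k (Set.range fun g : G i => π (mulSingleHom K i g) w) ⊓
        Representation.fixedPoints (π.comp (mulSingleHom K i)) (K i) = k ∙ w ∧
      ∀ X : Submodule k W,
        X ≤ Submodule.span k (Set.range fun g : G i => π (mulSingleHom K i g) w) →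
        (∀ g : G i, ∀ x ∈ X, π (mulSingleHom K i g) x ∈ X) →
        X = ⊥ ∨ X = Submodule.span k (Set.range fun g : G i => π (mulSingleHom K i g) w) := by
  haveI := isHeckeTriple_top_of_isCompact_isOpen (K i) hKc hK
  have hwK : w ∈ Representation.fixedPoints (π.comp (mulSingleHom K i)) (K i) :=
    hLi ▸ fixedPoints_boxSubgroup_le π L i hwU
  have hle : Submodule.span k (Set.range fun g : G i => π (mulSingleHom K i g) w) ⊓
      Representation.fixedPoints (π.comp (mulSingleHom K i)) (K i) ≤ k ∙ w := by
    intro z hz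
    obtain ⟨hz1, hz2⟩ := Submodule.mem_inf.1 hz
    obtain ⟨c, rfl⟩ := exists_eq_smul_of_mem_span_of_heckeEigenvector (π.comp (mulSingleHom K i))
      (K i) (finite_orbit_quotient (K i)) hwK heig hz1 hz2
    exact Submodule.smul_mem _ c (Submodule.mem_span_singleton_self w)
  have hge : k ∙ w ≤ Submodule.span k (Set.range fun g : G i => π (mulSingleHom K i g) w) ⊓
      Representation.fixedPoints (π.comp (mulSingleHom K i)) (K i) := by
    rw [Submodule.span_singleton_le_iff_mem]
    exact Submodule.mem_inf.2 ⟨self_mem_span_range_mulSingleHom π i w, hwK⟩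
  refine ⟨le_antisymm hle hge, fun X hX hXst => ?_⟩
  by_cases hX0 : X = ⊥
  · exact Or.inl hX0
  refine Or.inr (le_antisymm hX (span_range_mulSingleHom_le π i hXst ?_))
  -- `X` has a non-zero `K i`-fixed vector, a multiple of `w`
  have hWK : Representation.fixedPoints (π.comp (mulSingleHom K i)) (K i) ≠ ⊥ :=
    (Submodule.ne_bot_iff _).2 ⟨w, hwK, hw0⟩
  have hXK := inf_fixedPoints_comp_ne_bot π hπ hKc hWK hXst hX0
  obtain ⟨y, hy, hy0⟩ := (Submodule.ne_bot_iff _).1 hXK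
  obtain ⟨hyX, hyK⟩ := Submodule.mem_inf.1 hy
  have hyw : y ∈ k ∙ w := hle (Submodule.mem_inf.2 ⟨hX hyX, hyK⟩)
  obtain ⟨c, rfl⟩ := Submodule.mem_span_singleton.1 hyw
  have hc : c ≠ 0 := fun h => hy0 (by rw [h, zero_smul])
  have := X.smul_mem c⁻¹ hyX
  rwa [smul_smul, inv_mul_cancel₀ hc, one_smul] at this

end Hecke

/-! ### Purification at the bad places and the base vector -/

section Purify

variable [∀ i, TopologicalSpace (G i)] [∀ i, IsTopologicalGroup (G i)]

/-- **Purification at one place.** Let `π` be irreducible and admissible over `k` of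
characteristic `0`, `U = ∏ L j` a compact open box (`L j ≤ K j`, `= K j` almost everywhere) and
`w ∈ W^U` non-zero. For an index `i₀` there is a non-zero `w' ∈ W^U` such that `C_{i₀}(w')` is
irreducible, together with an endomorphism `T` of `W` commuting with all the other coordinate
embeddings `ι_j(G j)`, `j ≠ i₀`, and sending `w` to `w'`. Indeed `C_{i₀}(w)` is `G_{i₀}`-stable,
its `L_{i₀}`-fixed vectors lie in `W^U` (finite-dimensional) and contain `w`, and the dichotomy
holds below it, so it contains an irreducible stable `V` with a non-zero `L_{i₀}`-fixed `w'`
(`exists_irreducible_stable_le`); `C_{i₀}(w') = V`, and `w' ∈ C_{i₀}(w)` is `T w` for some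
`T ∈ span π(ι_{i₀} G_{i₀})`. (The reduction of Bump (1997), Prop. 3.4.1, p. 302 — "any nonzero
`A`-module of minimal dimension is simple" — run inside `W`.) [folklore] -/
theorem exists_purified_at [CharZero k] [π.IsIrreducible] (hadm : π.IsAdmissible)
    {L : ∀ i, Subgroup (G i)} (hLo : ∀ i, IsOpen (L i : Set (G i)))
    (hLc : ∀ i, IsCompact (L i : Set (G i))) (hLK : ∀ i, L i ≤ K i)
    (hLK' : ∀ᶠ i in cofinite, L i = K i) {w : W} (hwU : w ∈ π.fixedPoints (boxSubgroup L))
    (hw0 : w ≠ 0) (i₀ : ι) :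
    ∃ w' ∈ π.fixedPoints (boxSubgroup L), w' ≠ 0 ∧
      (∀ X : Submodule k W,
        X ≤ Submodule.span k (Set.range fun g : G i₀ => π (mulSingleHom K i₀ g) w') →
        (∀ g : G i₀, ∀ x ∈ X, π (mulSingleHom K i₀ g) x ∈ X) →
        X = ⊥ ∨ X = Submodule.span k (Set.range fun g : G i₀ => π (mulSingleHom K i₀ g) w')) ∧
      ∃ T : W →ₗ[k] W, T w = w' ∧
        ∀ j, j ≠ i₀ → ∀ (x : G j) (v : W),
          T (π (mulSingleHom K j x) v) = π (mulSingleHom K j x) (T v) := by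
  have hπ : π.IsSmooth := hadm.1
  set Z : Submodule k W := Submodule.span k (Set.range fun g : G i₀ => π (mulSingleHom K i₀ g) w)
    with hZ
  set F : Submodule k W := Representation.fixedPoints (π.comp (mulSingleHom K i₀)) (L i₀) with hF
  have hZst : ∀ g : G i₀, ∀ z ∈ Z, π (mulSingleHom K i₀ g) z ∈ Z :=
    fun g z hz => apply_mem_span_range_mulSingleHom π i₀ w g hz
  -- `Z ≤ W^{box (update L i₀ ⊥)}`, hence `Z ⊓ F ≤ W^U` is finite-dimensional
  have hZle : Z ≤ π.fixedPoints (boxSubgroup (Function.update L i₀ ⊥)) :=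
    span_range_mulSingleHom_le_fixedPoints_update_bot π L i₀
      (mem_fixedPoints_boxSubgroup_update_bot π L i₀ hwU)
  have hZF : Z ⊓ F ≤ π.fixedPoints (boxSubgroup L) := fun z hz =>
    mem_fixedPoints_boxSubgroup_of π L i₀ (hZle (Submodule.mem_inf.1 hz).1)
      (Submodule.mem_inf.1 hz).2
  haveI : Module.Finite k ↥(π.fixedPoints (boxSubgroup L)) :=
    finite_fixedPoints_boxSubgroup π hadm hLo hLc hLK hLK'
  haveI : Module.Finite k ↥(Z ⊓ F) := Submodule.finiteDimensional_of_le hZF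
  have hwF : w ∈ F := fixedPoints_boxSubgroup_le π L i₀ hwU
  have hZF0 : Z ⊓ F ≠ ⊥ :=
    (Submodule.ne_bot_iff _).2 ⟨w, Submodule.mem_inf.2 ⟨self_mem_span_range_mulSingleHom π i₀ w,
      hwF⟩, hw0⟩
  have hF0 : F ≠ ⊥ := (Submodule.ne_bot_iff _).2 ⟨w, hwF, hw0⟩
  have hdich : ∀ Y : Submodule k W, Y ≤ Z →
      (∀ g : G i₀, ∀ y ∈ Y, π (mulSingleHom K i₀ g) y ∈ Y) → Y ≠ ⊥ → Y ⊓ F ≠ ⊥ :=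
    fun Y _ hYst hY0 => inf_fixedPoints_comp_ne_bot π hπ (hLc i₀) hF0 hYst hY0
  obtain ⟨V, hVZ, hVst, hVF, hVirr⟩ :=
    exists_irreducible_stable_le (π.comp (mulSingleHom K i₀)) F Z hZst hZF0 hdich
  obtain ⟨w', hw', hw'0⟩ := (Submodule.ne_bot_iff _).1 hVF
  obtain ⟨hw'V, hw'F⟩ := Submodule.mem_inf.1 hw'
  have hw'U : w' ∈ π.fixedPoints (boxSubgroup L) :=
    mem_fixedPoints_boxSubgroup_of π L i₀ (hZle (hVZ hw'V)) hw'F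
  -- `C_{i₀}(w') = V`
  have hCle : Submodule.span k (Set.range fun g : G i₀ => π (mulSingleHom K i₀ g) w') ≤ V :=
    span_range_mulSingleHom_le π i₀ hVst hw'V
  have hCeq : Submodule.span k (Set.range fun g : G i₀ => π (mulSingleHom K i₀ g) w') = V := by
    rcases hVirr _ hCle (fun g x hx => apply_mem_span_range_mulSingleHom π i₀ w' g hx) with h | h
    · exact absurd h (span_range_mulSingleHom_ne_bot π i₀ hw'0)
    · exact h
  -- `w' = T w` with `T ∈ span π(ι_{i₀} G_{i₀})`
  have hw'Z : w' ∈ Z := hVZ hw'V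
  obtain ⟨c, hc⟩ := (Finsupp.mem_span_range_iff_exists_finsupp).1 hw'Z
  let T : W →ₗ[k] W := c.sum fun g a => a • π (mulSingleHom K i₀ g)
  have hT : ∀ v : W, T v = c.sum fun g a => a • π (mulSingleHom K i₀ g) v := fun v => by
    simp only [T, Finsupp.sum, LinearMap.sum_apply, LinearMap.smul_apply]
  refine ⟨w', hw'U, hw'0, hCeq ▸ hVirr, T, ?_, fun j hj x v => ?_⟩
  · rw [hT, ← hc]
  · rw [hT, hT, Finsupp.sum, Finsupp.sum, map_sum]
    refine Finset.sum_congr rfl fun g _ => ?_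
    have hc : mulSingleHom K i₀ g * mulSingleHom K j x = mulSingleHom K j x * mulSingleHom K i₀ g :=
      (mulSingle_commute_of_ne (Ne.symm hj) g x).eq
    rw [map_smul, ← Module.End.mul_apply, ← map_mul, hc, map_mul, Module.End.mul_apply]

/-- **Purification at finitely many places.** Under the hypotheses of `exists_purified_at`, for
every finite set `B` of indices there is a non-zero `w' ∈ W^U` with `C_i(w')` irreducible for all
`i ∈ B`, together with an endomorphism `T` commuting with the coordinate embeddings off `B` and
sending `w` to `w'` (induction on `B`; irreducibility at the places already treated is
transported along `T` by `map_stable_irreducible_of_comm`). [folklore] -/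
theorem exists_purified [CharZero k] [π.IsIrreducible] (hadm : π.IsAdmissible)
    {L : ∀ i, Subgroup (G i)} (hLo : ∀ i, IsOpen (L i : Set (G i)))
    (hLc : ∀ i, IsCompact (L i : Set (G i))) (hLK : ∀ i, L i ≤ K i)
    (hLK' : ∀ᶠ i in cofinite, L i = K i) {w : W} (hwU : w ∈ π.fixedPoints (boxSubgroup L))
    (hw0 : w ≠ 0) (B : Finset ι) :
    ∃ w' ∈ π.fixedPoints (boxSubgroup L), w' ≠ 0 ∧
      (∀ i ∈ B, ∀ X : Submodule k W,
        X ≤ Submodule.span k (Set.range fun g : G i => π (mulSingleHom K i g) w') →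
        (∀ g : G i, ∀ x ∈ X, π (mulSingleHom K i g) x ∈ X) →
        X = ⊥ ∨ X = Submodule.span k (Set.range fun g : G i => π (mulSingleHom K i g) w')) ∧
      ∃ T : W →ₗ[k] W, T w = w' ∧
        ∀ j, j ∉ B → ∀ (x : G j) (v : W),
          T (π (mulSingleHom K j x) v) = π (mulSingleHom K j x) (T v) := by
  classical
  induction B using Finset.induction_on with
  | empty =>
    exact ⟨w, hwU, hw0, fun i hi => absurd hi (Finset.notMem_empty i), LinearMap.id, rfl,
      fun j _ x v => rfl⟩
  | insert i₀ B hi₀ ih =>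
    obtain ⟨w₁, hw₁U, hw₁0, hirr₁, T₁, hT₁w, hT₁⟩ := ih
    obtain ⟨w₂, hw₂U, hw₂0, hirr₂, T₂, hT₂w, hT₂⟩ :=
      exists_purified_at π hadm hLo hLc hLK hLK' hw₁U hw₁0 i₀
    refine ⟨w₂, hw₂U, hw₂0, fun i hi => ?_, T₂ ∘ₗ T₁, by simp [hT₁w, hT₂w], fun j hj x v => ?_⟩
    · rcases Finset.mem_insert.1 hi with rfl | hiB
      · exact hirr₂
      · -- transport irreducibility at `i ∈ B` along `T₂` (which commutes with `ι_i`, `i ≠ i₀`)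
        have hne : i ≠ i₀ := fun h => hi₀ (h ▸ hiB)
        have hcomm : ∀ (x : G i) (v : W),
            T₂ (π (mulSingleHom K i x) v) = π (mulSingleHom K i x) (T₂ v) := hT₂ i hne
        have hmap := map_span_range_mulSingleHom π i w₁ T₂ hcomm
        rw [hT₂w] at hmap
        rw [← hmap]
        exact map_stable_irreducible_of_comm (π.comp (mulSingleHom K i))
          (fun g v hv => apply_mem_span_range_mulSingleHom π i w₁ g hv) (hirr₁ i hiB) T₂ hcomm
    · rw [LinearMap.comp_apply, LinearMap.comp_apply,
        hT₁ j (fun h => hj (Finset.mem_insert_of_mem h)),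
        hT₂ j (fun h => hj (h ▸ Finset.mem_insert_self i₀ B))]

/-- **The purified base vector (Flath's theorem, existence half: the local data).** Let `π` be an
irreducible admissible representation of `Πʳ i, [G i, K i]` (topological groups `G i`, compact
open `K i`, `(G i, K i)` a Gelfand pair for almost all `i`) over an algebraically closed field of
characteristic `0`. Then there are a compact open box `U = ∏ L i` (`L i ≤ K i`, `L i = K i` for
almost all `i`) and a non-zero `w⋆ ∈ W^U` such that every cyclic module
`C_i(w⋆) = span {π(ι_i g) w⋆}` is an irreducible `G i`-stable subspace of `W`, and for almost all
`i` its `ι_i(K i)`-fixed vectors are exactly `k w⋆`. These `C_i(w⋆)` are the local factors of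
`π` (Flath 1979, Thm. 3 with Thm. 2: "`W ≅ ⊗' W_v` with `dim W_v^{K_v} = 1` for almost all `v`";
Bump 1997, Thm. 3.4.4), as completed in `AutomorphicGLnFlathProofs`.
[cite: FlathCorvallis1979, Theorem 2 and Theorem 3] -/
theorem exists_flathBaseVector [IsAlgClosed k] [CharZero k] [π.IsIrreducible]
    (hK : ∀ i, IsOpen (K i : Set (G i)))
    (hKc : ∀ i, IsCompact (K i : Set (G i)))
    (hGP : ∀ᶠ i in cofinite, IsGelfandPair k (G i) (K i)) (hadm : π.IsAdmissible) :
    ∃ (L : ∀ i, Subgroup (G i)) (w : W), (∀ i, IsOpen (L i : Set (G i))) ∧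
      (∀ i, IsCompact (L i : Set (G i))) ∧ (∀ i, L i ≤ K i) ∧ (∀ᶠ i in cofinite, L i = K i) ∧
      w ∈ π.fixedPoints (boxSubgroup L) ∧ w ≠ 0 ∧
      (∀ i, ∀ X : Submodule k W,
        X ≤ Submodule.span k (Set.range fun g : G i => π (mulSingleHom K i g) w) →
        (∀ g : G i, ∀ x ∈ X, π (mulSingleHom K i g) x ∈ X) →
        X = ⊥ ∨ X = Submodule.span k (Set.range fun g : G i => π (mulSingleHom K i g) w)) ∧
      ∀ᶠ i in cofinite,
        Submodule.span k (Set.range fun g : G i => π (mulSingleHom K i g) w) ⊓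
          Representation.fixedPoints (π.comp (mulSingleHom K i)) (K i) = k ∙ w := by
  classical
  have hπ : π.IsSmooth := hadm.1
  obtain ⟨L, hLo, hLc, hLK, hLK', hU⟩ := exists_boxSubgroup_fixedPoints_ne_bot π hK hKc hπ
  haveI : Module.Finite k ↥(π.fixedPoints (boxSubgroup L)) :=
    finite_fixedPoints_boxSubgroup π hadm hLo hLc hLK hLK'
  -- a common eigenvector of the good local Hecke operators
  obtain ⟨w₁, hw₁U, hw₁0, heig₁⟩ := exists_common_heckeEigenvector π hK hKc hU
  -- the finite bad set
  have hbad : {i | ¬ (L i = K i ∧ IsGelfandPair k (G i) (K i))}.Finite := by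
    have : ∀ᶠ i in cofinite, L i = K i ∧ IsGelfandPair k (G i) (K i) := hLK'.and hGP
    exact Filter.eventually_cofinite.1 this
  set B : Finset ι := hbad.toFinset with hB
  have hgood : ∀ i ∉ B, L i = K i ∧ IsGelfandPair k (G i) (K i) := fun i hi => by
    by_contra h
    exact hi (hbad.mem_toFinset.2 h)
  -- purify at the bad places
  obtain ⟨w, hwU, hw0, hirr, T, hTw, hT⟩ := exists_purified π hadm hLo hLc hLK hLK' hw₁U hw₁0 B
  -- the eigenvector property at the good places survives
  have heig : ∀ i ∉ B, ∀ g : G i, ∃ c : k,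
      heckeOperator (π.comp (mulSingleHom K i)) (K i) g w = c • w := by
    intro i hi g
    obtain ⟨c, hc⟩ := heig₁ i (hgood i hi).1 (hgood i hi).2 g
    refine ⟨c, ?_⟩
    haveI := isHeckeTriple_top_of_isCompact_isOpen (K i) (hKc i) (hK i)
    rw [← hTw, ← apply_heckeOperator_eq_of_forall_comm (π.comp (mulSingleHom K i)) (K i) g
      (finite_orbit_quotient (K i) g) T (hT i hi) w₁, hc, map_smul]
  have hgood' : ∀ i ∉ B, Submodule.span k (Set.range fun g : G i => π (mulSingleHom K i g) w) ⊓
        Representation.fixedPoints (π.comp (mulSingleHom K i)) (K i) = k ∙ w ∧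
      ∀ X : Submodule k W,
        X ≤ Submodule.span k (Set.range fun g : G i => π (mulSingleHom K i g) w) →
        (∀ g : G i, ∀ x ∈ X, π (mulSingleHom K i g) x ∈ X) →
        X = ⊥ ∨ X = Submodule.span k (Set.range fun g : G i => π (mulSingleHom K i g) w) :=
    fun i hi => irreducible_span_of_heckeEigenvector π hπ (hgood i hi).1 (hK i) (hKc i) hwU hw0
      (heig i hi)
  refine ⟨L, w, hLo, hLc, hLK, hLK', hwU, hw0, fun i => ?_, ?_⟩
  · by_cases hi : i ∈ B
    · exact hirr i hi
    · exact (hgood' i hi).2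
  · refine Filter.eventually_cofinite.2 (hbad.subset fun i hi => ?_)
    by_contra hib
    exact hi (hgood' i (fun h => hib (hbad.mem_toFinset.1 h))).1

end Purify

end Literature.NumberTheory.Automorphic
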